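import Mathlib
import Summits.Ventures.PercRepro2.TypedResidualSplit
import Summits.Ventures.PercRepro2.TypedSeparatedAll

/-!
# The crux of record is (TRI) on the root-connected residual class (blind cell PercRepro2, p2 g0,
2026-08-25; sub-claim S1, `proofs/subclaims/S1-REDUCTION.md`; the lead's assembly ask, INBOX
2026-08-25T01:05:05Z / 01:08:12Z / 01:18:38Z (5))

Sub-claim S2 (night-3 / p3, `TypedSeparatedAll.lean`: `Separated.typedCount_nonneg_of_typedConfig_sep`
— (TRI) at the all-closed pinning whenever `a₁`, `a₂` lie in different components of the typed
graph) discharges the separated part of the residual class `NR` of sub-claim S1. Hence: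

* **`residualSep_all`** — `ResidualSep_all R` is a theorem;
* **`HCov_all_of_residualCon_all`** — THE CRUX OF RECORD `HCov_all R` (DEMO-PACKET §(c)) follows from
  `ResidualCon_all R` alone: row 2′TRI at `z ≡ false` on the residual instances whose roots are
  connected in the typed graph — sub-claim S4's domain, literally.

The refinements by mark coincidences are in `TypedResidualCruxMarks.lean`. Own code; standard
axioms.
-/

namespace Summit.Ventures.PercRepro2

open UnionCluster

namespace CovForm

namespace TypedRed

section Crux

variable (R : Type*) [Field R] [LinearOrder R] [IsStrictOrderedRing R]

/-- **The separated part of `NR` is discharged by sub-claim S2** (the full separated-class theorem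
`Separated.typedCount_nonneg_of_typedConfig_sep`; the `Residual` side conditions are not needed). -/
theorem residualSep_all : ResidualSep_all R := by
  intro V E _ _ _ _ ends o a₁ a₂ a₃ b F τ hτ hres
  exact Separated.typedCount_nonneg_of_typedConfig_sep ends o a₁ a₂ a₃ b F τ hτ hres.sep

/-- **THE CRUX OF RECORD FROM (TRI) ON THE ROOT-CONNECTED RESIDUAL CLASS**: `HCov_all R` follows
from `ResidualCon_all R` — sub-claim S4's domain — alone (S1's spine + S2). -/
theorem HCov_all_of_residualCon_all (hc : ResidualCon_all R) : HCov_all R :=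
  HCov_all_of_sep_con R (residualSep_all R) hc

end Crux

end TypedRed

end CovForm

end Summit.Ventures.PercRepro2
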